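import Summits.Parity.GeneralizedHardyLittlewood.Theses.LiouvilleShiftedTables
import Summits.Parity.GeneralizedHardyLittlewood.Theorems.TableChowla.Negative.TableChowlaExceptionalSet

/-!
# `TableChowla` (stmt-Parity-14270) follows from uniform binary Chowla for the SHORT two-form sums

Support lemma for the crux `LiouvilleShiftedTables.TableChowla` (cdisprove seat), dual to
`TableChowlaOfUniformBinaryChowla`: `tableChowla_of_uniformShortBinaryChowla :
UniformShortBinaryChowla → TableChowla`, where the hypothesis asks
`|Σ_{a ∈ (A,2A]} λ(ab+c)λ(ab'+c)| ≤ rows/(log x)^C` uniformly for distinct columns `b ≠ b' ≤ x` and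
`x^δ ≤ A ≤ x` (short sums of length `≍ A ≥ x^δ`; a Chowla-in-short-ranges conjecture, believed for
every fixed `δ > 0`). Core: `momentN_le_of_offDiag_cols` (`T ≤ B·rows² + B²(ε·rows)²`, by the
column form of the moment). Hence a counterexample to the crux would refute both the long-sum
(Elliott-type) and the short-sum (Matomäki–Radziwiłł-type) uniform conjectures. [folklore]
-/

namespace Summit.Parity.GeneralizedHardyLittlewood.Theorems.TableChowla.Negative

open Finset Real ArithmeticFunction
open Summit.Parity.GeneralizedHardyLittlewood.Theses

noncomputable section

/-- Column correlation (SHORT sum over the rows) `G(b,b') = Σ_{a ∈ (A₁,A₂]} f(ab+c) f(ab'+c)`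
(a SHORT sum, length the number of rows). -/
def colCorrS (f : ℕ → ℝ) (c : ℤ) (A₁ A₂ b b' : ℕ) : ℝ :=
  ∑ a ∈ Ioc A₁ A₂, f (Int.toNat ((a : ℤ) * b + c)) * f (Int.toNat ((a : ℤ) * b' + c))

/-- HYPOTHESIS — uniform binary Chowla for SHORT two-form sums over the rows of the window. -/
def UniformShortBinaryChowla : Prop :=
  ∀ c : ℤ, c ≠ 0 → ∀ δ : ℝ, 0 < δ → ∀ C : ℝ, 0 < C → ∃ x₀ : ℝ, ∀ x : ℝ, x₀ ≤ x →
    ∀ A : ℝ, x ^ δ ≤ A → A ≤ x → ∀ b b' : ℕ, b ≠ b' → (b : ℝ) ≤ x → (b' : ℝ) ≤ x →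
      |colCorrS lam c ⌊A⌋₊ ⌊2 * A⌋₊ b b'| ≤ ((⌊2 * A⌋₊ - ⌊A⌋₊ : ℕ) : ℝ) / Real.log x ^ C

variable {f : ℕ → ℝ} {c : ℤ} {A₁ A₂ B : ℕ}

/-- Trivial bound `|G(b,b')| ≤ rows` for `|f| ≤ 1`. -/
theorem abs_colCorrS_le (hf : ∀ n, |f n| ≤ 1) (b b' : ℕ) :
    |colCorrS f c A₁ A₂ b b'| ≤ ((A₂ - A₁ : ℕ) : ℝ) := by
  unfold colCorrS
  calc |∑ a ∈ Ioc A₁ A₂, f (Int.toNat ((a : ℤ) * b + c)) * f (Int.toNat ((a : ℤ) * b' + c))|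
        ≤ ∑ a ∈ Ioc A₁ A₂, |f (Int.toNat ((a : ℤ) * b + c)) * f (Int.toNat ((a : ℤ) * b' + c))| :=
          abs_sum_le_sum_abs _ _
    _ ≤ ∑ _a ∈ Ioc A₁ A₂, (1 : ℝ) := by
          refine sum_le_sum fun a _ => ?_
          rw [abs_mul]
          exact mul_le_one₀ (hf _) (abs_nonneg _) (hf _)
    _ = ((A₂ - A₁ : ℕ) : ℝ) := by simp

/-- COMBINATORIAL CORE (columns): if every OFF-diagonal column correlation is `≤ ε·rows` then
`T ≤ B·rows² + B²·(ε·rows)²`. -/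
theorem momentN_le_of_offDiag_cols (hf : ∀ n, |f n| ≤ 1) {ε : ℝ}
    (hoff : ∀ b ∈ Icc 1 B, ∀ b' ∈ Icc 1 B, b ≠ b' → |colCorrS f c A₁ A₂ b b'| ≤ ε * ((A₂ - A₁ : ℕ) : ℝ)) :
    momentN f c A₁ A₂ B ≤ (B : ℝ) * ((A₂ - A₁ : ℕ) : ℝ) ^ 2 + (B : ℝ) ^ 2 * (ε * ((A₂ - A₁ : ℕ) : ℝ)) ^ 2 := by
  rw [momentN_eq_colMoment]
  have hG : ∀ b b' : ℕ, (∑ a ∈ Ioc A₁ A₂, f (Int.toNat ((a : ℤ) * b + c)) * f (Int.toNat ((a : ℤ) * b' + c))) =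
      colCorrS f c A₁ A₂ b b' := fun _ _ => rfl
  simp_rw [hG]
  have hrow : ∀ b ∈ Icc 1 B, ∑ b' ∈ Icc 1 B, colCorrS f c A₁ A₂ b b' ^ 2 ≤
      ((A₂ - A₁ : ℕ) : ℝ) ^ 2 + B * (ε * ((A₂ - A₁ : ℕ) : ℝ)) ^ 2 := by
    intro b hb
    rw [← Finset.add_sum_erase _ _ hb]
    have hdiag : colCorrS f c A₁ A₂ b b ^ 2 ≤ ((A₂ - A₁ : ℕ) : ℝ) ^ 2 := by
      have h1 := abs_colCorrS_le (c := c) (A₁ := A₁) (A₂ := A₂) hf b b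
      exact sq_le_sq' (by linarith [(abs_le.mp h1).1]) (abs_le.mp h1).2
    have hoffsum : ∑ b' ∈ (Icc 1 B).erase b, colCorrS f c A₁ A₂ b b' ^ 2 ≤ B * (ε * ((A₂ - A₁ : ℕ) : ℝ)) ^ 2 := by
      calc ∑ b' ∈ (Icc 1 B).erase b, colCorrS f c A₁ A₂ b b' ^ 2
          ≤ ∑ _b' ∈ (Icc 1 B).erase b, (ε * ((A₂ - A₁ : ℕ) : ℝ)) ^ 2 := by
            refine sum_le_sum fun b' hb' => ?_
            have hne : b ≠ b' := (Finset.ne_of_mem_erase hb').symm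
            have hmem : b' ∈ Icc 1 B := Finset.mem_of_mem_erase hb'
            have h1 := hoff b hb b' hmem hne
            exact sq_le_sq' (by linarith [(abs_le.mp h1).1]) (abs_le.mp h1).2
        _ ≤ ∑ _b' ∈ Icc 1 B, (ε * ((A₂ - A₁ : ℕ) : ℝ)) ^ 2 :=
            sum_le_sum_of_subset_of_nonneg (erase_subset _ _) (fun _ _ _ => sq_nonneg _)
        _ = B * (ε * ((A₂ - A₁ : ℕ) : ℝ)) ^ 2 := by simp
    linarith
  calc ∑ b ∈ Icc 1 B, ∑ b' ∈ Icc 1 B, colCorrS f c A₁ A₂ b b' ^ 2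
      ≤ ∑ _b ∈ Icc 1 B, (((A₂ - A₁ : ℕ) : ℝ) ^ 2 + B * (ε * ((A₂ - A₁ : ℕ) : ℝ)) ^ 2) := sum_le_sum hrow
    _ = _ := by simp only [sum_const, Nat.card_Icc, Nat.add_sub_cancel, nsmul_eq_mul]; ring

/-- DUAL RESISTANCE THEOREM: `UniformShortBinaryChowla → TableChowla` (diagonal `B·rows² ≤ 4x·x^{5/12}
≤ x²/(2(log x)^C)` once `8(log x)^C ≤ x^{7/12}`; off-diagonal `(rows·B)²/(log x)^{2C} ≤ 4x²/(log x)^{2C}`). -/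
theorem tableChowla_of_uniformShortBinaryChowla (h : UniformShortBinaryChowla) :
    LiouvilleShiftedTables.TableChowla := by
  rw [tableChowla_iff]
  intro c hc δ hδ hδ' C hC
  obtain ⟨x₁, hx₁⟩ := h c hc δ hδ C hC
  obtain ⟨X₁, hX₁⟩ := eventually_log_rpow_le (show (0 : ℝ) < 7 / 12 by norm_num) (C + 1)
  obtain ⟨X₂, hX₂⟩ := eventually_rpow_log_ge hC 8
  refine ⟨max (max x₁ 1) (max X₁ X₂), fun x hx A hA hA' => ?_⟩
  have hxx₁ : x₁ ≤ x := le_trans (le_trans (le_max_left _ _) (le_max_left _ _)) hx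
  have hx1 : 1 ≤ x := le_trans (le_trans (le_max_right _ _) (le_max_left _ _)) hx
  have hxX₁ : X₁ ≤ x := le_trans (le_trans (le_max_left _ _) (le_max_right _ _)) hx
  have hxX₂ : X₂ ≤ x := le_trans (le_trans (le_max_right _ _) (le_max_right _ _)) hx
  have hxpos : 0 < x := by linarith
  obtain ⟨hL8, hlog2⟩ := hX₂ x hxX₂
  obtain ⟨h4, _⟩ := hX₁ x hxX₁
  have hlogpos : 0 < Real.log x := by linarith
  set L : ℝ := Real.log x ^ C with hL
  have hLpos : 0 < L := Real.rpow_pos_of_pos hlogpos C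
  have hL' : Real.log x ^ (C + 1) = L * Real.log x := by rw [hL, Real.rpow_add hlogpos, Real.rpow_one]
  rw [hL'] at h4
  have h8L : 8 * L ≤ x ^ ((7 : ℝ) / 12) := by nlinarith
  have hAone : 1 ≤ A := le_trans (Real.one_le_rpow hx1 hδ.le) hA
  have hApos : 0 < A := by linarith
  have hAx : A ≤ x := hA'.trans (by
    calc x ^ (1 / 3 + δ) ≤ x ^ (1 : ℝ) := Real.rpow_le_rpow_of_exponent_le hx1 (by linarith)
      _ = x := Real.rpow_one x)
  have hA512 : A ≤ x ^ ((5 : ℝ) / 12) := hA'.trans (Real.rpow_le_rpow_of_exponent_le hx1 (by linarith))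
  set S : ℕ := ⌊2 * A⌋₊ - ⌊A⌋₊ with hS
  set Bn : ℕ := ⌊x / A⌋₊ with hBn
  have hrows : (S : ℝ) ≤ 2 * A := by
    rw [hS, Nat.cast_sub (Nat.floor_le_floor (by linarith : A ≤ 2 * A))]
    have h1 : (⌊2 * A⌋₊ : ℝ) ≤ 2 * A := Nat.floor_le (by linarith)
    have h2 : A - 1 < (⌊A⌋₊ : ℝ) := by have := Nat.lt_floor_add_one A; linarith
    linarith
  have hBle : (Bn : ℝ) ≤ x / A := Nat.floor_le (by positivity)
  have hBx : (Bn : ℝ) ≤ x := hBle.trans (div_le_self hxpos.le hAone)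
  have hRB : (S : ℝ) * Bn ≤ 2 * x := by
    calc (S : ℝ) * Bn ≤ (2 * A) * (x / A) := mul_le_mul hrows hBle (by positivity) (by positivity)
      _ = 2 * x := by field_simp
  have hbcol : ∀ b ∈ Icc 1 Bn, (b : ℝ) ≤ x := by
    intro b hb; rw [mem_Icc] at hb
    exact le_trans (by exact_mod_cast hb.2) hBx
  have hoff : ∀ b ∈ Icc 1 Bn, ∀ b' ∈ Icc 1 Bn, b ≠ b' →
      |colCorrS lam c ⌊A⌋₊ ⌊2 * A⌋₊ b b'| ≤ 1 / L * ((⌊2 * A⌋₊ - ⌊A⌋₊ : ℕ) : ℝ) := by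
    intro b hb b' hb' hne
    have := hx₁ x hxx₁ A hA hAx b b' hne (hbcol b hb) (hbcol b' hb')
    rw [hL, one_div_mul_eq_div]; exact this
  have hT := momentN_le_of_offDiag_cols (f := lam) (c := c) (A₁ := ⌊A⌋₊) (A₂ := ⌊2 * A⌋₊) (B := Bn)
    abs_lam_le_one hoff
  rw [← hS] at hT
  -- diagonal: Bn S² ≤ (S Bn) S ≤ 2x · 2A ≤ 4 x · x^{5/12} ≤ x²/(2L)
  have hx712 : x ^ ((5 : ℝ) / 12) * x ^ ((7 : ℝ) / 12) = x := by
    rw [← Real.rpow_add hxpos]; norm_num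
  have t1 : (Bn : ℝ) * (S : ℝ) ^ 2 ≤ x ^ 2 / (2 * L) := by
    have hstep : (Bn : ℝ) * (S : ℝ) ^ 2 ≤ 4 * x * x ^ ((5 : ℝ) / 12) := by
      calc (Bn : ℝ) * (S : ℝ) ^ 2 = ((S : ℝ) * Bn) * S := by ring
        _ ≤ (2 * x) * (2 * A) := mul_le_mul hRB hrows (Nat.cast_nonneg _) (by positivity)
        _ = 4 * x * A := by ring
        _ ≤ 4 * x * x ^ ((5 : ℝ) / 12) := mul_le_mul_of_nonneg_left hA512 (by positivity)
    refine le_trans hstep ?_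
    rw [le_div_iff₀ (by positivity)]
    -- 4 x x^{5/12} · 2L = x^{5/12} x · 8L ≤ x^{5/12} · x · x^{7/12} = x²
    have hx512pos : 0 < x ^ ((5 : ℝ) / 12) := Real.rpow_pos_of_pos hxpos _
    nlinarith [mul_le_mul_of_nonneg_left h8L (le_of_lt (mul_pos hxpos hx512pos)), hx712]
  -- off-diagonal: Bn² (S/L)² = (S Bn)²/L² ≤ 4x²/L² ≤ x²/(2L)
  have t2 : (Bn : ℝ) ^ 2 * (1 / L * (S : ℝ)) ^ 2 ≤ x ^ 2 / (2 * L) := by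
    have e1 : (Bn : ℝ) ^ 2 * (1 / L * (S : ℝ)) ^ 2 = ((S : ℝ) * Bn) ^ 2 / L ^ 2 := by field_simp
    rw [e1, div_le_div_iff₀ (by positivity) (by positivity)]
    have hsb : ((S : ℝ) * Bn) ^ 2 ≤ (2 * x) ^ 2 := pow_le_pow_left₀ (by positivity) hRB 2
    nlinarith [mul_nonneg (sq_nonneg x) hLpos.le]
  have t5 : x ^ 2 / (2 * L) + x ^ 2 / (2 * L) = x ^ 2 / L := by field_simp; ring
  show momentN lam c ⌊A⌋₊ ⌊2 * A⌋₊ ⌊x / A⌋₊ ≤ x ^ 2 / L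
  rw [← hBn]
  linarith

end

end Summit.Parity.GeneralizedHardyLittlewood.Theorems.TableChowla.Negative
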